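import Summits.ABC.IUTFork.Conditional.AbcOfS
import Summits.ABC.IUTFork.Charitable.Thm311D4Upper
import HarnessLib

/-!
# Block D × branch C junction, team D4, HEDGED form: branch C's certificate with its residual supplied by the (Ind3)-HEDGED reading
# (L^⊆) of [IUTchIII] Thm. 3.11 (iii)(c) + a monotone region reading (`abc_of_upper_4`)

Proof-only file (D-0012) of the abc-iut cell, block D (maximally-charitable re-typings of [IUTchIII] Thm. 3.11), team D4, seat abc-iut-D4-prv
(gen 3); rung LADDER-ABC:A2.D (junction with A2.C). TAKES NO SIDE on [IUTchIII] Cor. 3.12. NO definition, NO `Prop` fact. ONE theorem,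
compositional over LANDED files: the Statement-level spine of abc-iut-C-cert-1's branch-C certificate `Conditional.abc_of_S_v2`
(Conditional/AbcOfS.lean: per genuine Θ-volume datum the typed Corollary `Cor312.Setting.Statement`, then the two READ equations,
`ThetaPartII.stub_thetaData`, `PointDict.logQAvoid_le_of_cor312AtDatum`, `ThetaPartIIDisplay.thm110Legendre_of_squeezeIII`,
`ABC_of_thm110Legendre`) with the typed Corollary now obtained from THIS seat's `D4Upper.statement_of_upper` (Charitable/Thm311D4Upper.lean,
p443687): team D4's literal Theorem 3.11 `D4.Thm311Literal_4` ∧ (Q′) `D4.QKummerCoric` ∧ the (Ind3)-HEDGED clause (L^⊆)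
`D4.LinkKummerCompatUpper` (abc-iut-D4-typ p433089 / p437900) + the two region pins + a region reading MONOTONE in the datum
(`D4Upper.RegionMonotone`) + `BridgeHyps` ⟹ the typed Corollary, through abc-iut-w5-d068's hull-level `PilotKummerCompatHull` (= branch C's
live line S_H since C-R10) and abc-iut-c312-1's (xi-f) `Licence`. S. Mochizuki, *Inter-universal Teichmüller theory III/IV* (kurims, May
2020); [claim: Mochizuki2012, status: disputed].

WHAT THE THEOREM SAYS — and what it does NOT. `abc_of_upper_4` is the sibling of this seat's `D4Derive.abc_of_charitable_4` (p434675) with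
[CHAR] («team D4's CHARITABLE Theorem 3.11», decisive clause (L) = «the q-pilot Kummer image IS an indeterminacy-translate of a Θ-pilot
Kummer image», graded STRONGER-THAN-PRINT in referee lanes 1–2) REPLACED by [CHAR⊆] = «team D4's literal Theorem 3.11 ∧ (Q′) ∧ the
hedge-honouring containment (L^⊆)» (abc-iut-D-ref lane 1, §L v3.1 ADDENDUM-d: «ARGUABLY-FAITHFUL, hedges carried») PLUS one new binder [MONO]
(the region reading is monotone in the datum — a property of the READING, not a clause of print). Every other binder is carried VERBATIM
from `abc_of_S_v2`: [PIN] the two region pins for the q-datum `(Q P l T).qΨ (P312 P l T).n (m₁ P l T)` + `BridgeHyps`; [CONE] `hvol`; [READ]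
`hΘ`, `hq`; [IUTchIII] Thm. 3.11 (ii)(b) at the setting's column is ABSORBED (a conjunct of `Thm311Literal_4`). Explicit `Prop` binders:
CHAR⊆ 1 · MONO 1 · PIN 2 · FACT 0 · CONE 1 · READ 2 = 7 (`abc_of_charitable_4`: 6; `abc_of_S_v2`: 7). So, IN KERNEL and ONLY in this
conditional sense: «`ABC` follows from the hedge-honouring reading of [IUTchIII] Thm. 3.11 (team D4) + a monotone region reading + the
Corollary's pins + the bridge hypotheses + the campaign-S hull-volume node + the two reading equations, as typed». HONEST CAVEAT, in
kernel: the antecedent [CHAR⊆] is UNSATISFIABLE at honest data exactly like [CHAR] — (L^⊆) is FALSE for PR-2's honest q-datum whatever the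
automorphism sets (`D4Upper.not_upper_pinned`, p443687) and fails at abc-iut-w4-d103's frame-flipped bed where the hull line S_H, the pins
and the typed Corollary all hold (`D4Upper.hull_rung_not_imp_upper`, p444434); the route passes through S_H, which is NOT refuted at honest
data. This is NOT a proof of abc, NOT an endorsement of any reading, and takes no side between authors (Mochizuki / Scholze–Stix / Joshi /
Dupuy–Hilado); typed ≠ proved; locates / conditionally verifies; no abc claim.
-/

noncomputable section

namespace Summit.ABC.IUTFork.Charitable.D4Upper

open Thm311 Cor312 Cor312Vol Literature.IUT.LogThetaLattice
open Summit.ABC.IUTFork.Charitable.D4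

open Literature.IUT.LogVolume Literature.NumberTheory.DiophantineGeometry.GenEll Summit.ABC.ABC.Theorems in
/-- **`abc_of_upper_4` — branch C's certificate spine with the typed Corollary supplied, per datum, by team D4's HEDGE-HONOURING Theorem
3.11 + a monotone region reading.** Per `λ`-line point `P`, prime `l` and genuine Θ-volume datum `T` (DATA: the typed lattice situation
`F P l T`, abc-iut-D4-typ's link/Kummer data `Q P l T`, the Cor.-3.12 setting `P312 P l T`, the region reading `ρ P l T`, a lattice position
`m₁ P l T`), the explicit hypotheses are: [CHAR⊆] `hUpper` = `Thm311Literal_4 ∧ QKummerCoric ∧ LinkKummerCompatUpper` at every datum · [MONO]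
`hMono` = `RegionMonotone (F P l T).L (ρ P l T)` · [PIN] `hPin` = the two region pins (pΘ)(pq′) for the q-datum
`(Q P l T).qΨ (P312 P l T).n (m₁ P l T)`, `hBridge` = `BridgeHyps` · [CONE] `hvol` = the hull-volume estimate at the genuine data (campaign S) ·
[READ] `hΘ`, `hq`. Route: `D4Upper.statement_of_upper` (with (i) `MultiradialCompat` and (ii)(b) read off `Thm311Literal_4`) gives
`Cor312.Setting.Statement` at every datum; then VERBATIM the Statement-level steps of `Conditional.abc_of_S_v2` (READ equations ⟹
`Cor22.Cor312AtDatum`; `ThetaPartII.stub_thetaData`, `PointDict.logQAvoid_le_of_cor312AtDatum`,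
`ThetaPartIIDisplay.thm110Legendre_of_squeezeIII`, `ABC_of_thm110Legendre`). CONDITIONAL; the antecedent [CHAR⊆] is refuted at honest data
(`not_upper_pinned`, `hull_rung_not_imp_upper`); no side taken on [IUTchIII] Cor. 3.12. [claim: Mochizuki2012, status: disputed] -/
theorem abc_of_upper_4
    -- DATA (uncounted)
    {TI : ∀ (P : NFPoint) (l : ℕ), Cor22.ThetaVolumeDatumAt P l → ThetaIndex}
    (F : ∀ (P : NFPoint) (l : ℕ) (T : Cor22.ThetaVolumeDatumAt P l), LatticeSituation (TI P l T))
    (Q : ∀ (P : NFPoint) (l : ℕ) (T : Cor22.ThetaVolumeDatumAt P l), D4.LinkKummerData (F P l T))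
    (P312 : ∀ (P : NFPoint) (l : ℕ) (T : Cor22.ThetaVolumeDatumAt P l), Cor312.Setting (F P l T).toSituation)
    (ρ : ∀ (P : NFPoint) (l : ℕ) (T : Cor22.ThetaVolumeDatumAt P l),
      (∀ v : (TI P l T).V, v ∈ (TI P l T).Vbad → Set ((F P l T).L.StarPacket v)) →
        ∀ (j : (TI P l T).Label) (vQ : (TI P l T).VQ), Set ((F P l T).L.Packet j vQ))
    (m₁ : ∀ (P : NFPoint) (l : ℕ), Cor22.ThetaVolumeDatumAt P l → ℤ)
    -- [CHAR⊆] team D4's literal Theorem 3.11 ∧ (Q′) ∧ the (Ind3)-hedged clause (L^⊆), at every datum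
    (hUpper : ∀ P l T, D4.Thm311Literal_4 (F P l T) (Q P l T) ∧ D4.QKummerCoric (F P l T) (Q P l T) ∧
      D4.LinkKummerCompatUpper (F P l T) (Q P l T))
    -- [MONO] the region reading is monotone in the datum
    (hMono : ∀ P l T, RegionMonotone (F P l T).L (ρ P l T))
    -- [PIN] the Corollary's two region pins for the q-datum `qΨ n m₁`, and the bridge hypotheses
    (hPin : ∀ P l T, Cor312Vol.PinnedRegions (F P l T) (P312 P l T) (ρ P l T) ((Q P l T).qΨ (P312 P l T).n (m₁ P l T)))
    (hBridge : ∀ P l T, Cor312Vol.BridgeHyps (P312 P l T))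
    -- [FACT] (none)
    -- [CONE] (ii′) the hull-volume estimate at the genuine data (campaign S); (ii)(b) is inside [CHAR⊆]
    (hvol : ∀ P : NFPoint, P ∈ UP → ∀ l : ℕ, l.Prime → 5 ≤ l →
      Cor22.AdmitsCore P → Cor22.CondP2 P l → Cor22.CondP5 P l → Cor22.CondP6 P l →
        Cor22.HullVolumeAtDatum P l (((l : ℝ) + 1) / 4 *
          ((1 + 12 * (Cor22.dmod P : ℝ) / l) * (P.logDiff + Cor22.logCondAvoid P {2, l})
            + 2 * Real.log l + 52
            + 20 / 3 * Real.log (((2 ^ 12 * 3 ^ 3 * 5 * Cor22.dmod P : ℕ) : ℝ) * (l : ℝ))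
              * (Nat.primeCounting (2 ^ 12 * 3 ^ 3 * 5 * Cor22.dmod P * l) : ℝ))))
    -- [READ] the setting's two numbers are the datum's defined numbers
    (hΘ : ∀ P l T (x : ℝ), (P312 P l T).negLogTheta = (x : WithTop ℝ) → T.negLogTheta = x)
    (hq : ∀ P l T, (P312 P l T).negLogQ = T.negAbsLogQ) :
    _root_.ABC := by
  -- Step 1: the typed Corollary at EVERY genuine Θ-volume datum, from the hedged reading + monotone reading + pins + bridge hypotheses
  have h312 : ∀ (P : NFPoint) (l : ℕ), Cor22.Cor312AtDatum P l := fun P l T => by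
    have hst : (P312 P l T).Statement :=
      statement_of_upper (P312 P l T) (ρ P l T) (hUpper P l T).1.1.2.2 (fun n => ((hUpper P l T).1.2.1 n).2.1)
        (hBridge P l T) (hPin P l T) (hMono P l T) (hUpper P l T).2.2
    obtain ⟨x, hx⟩ := WithTop.ne_top_iff_exists.mp hst.1
    have hle : (P312 P l T).negLogQ ≤ x := ((P312 P l T).statement_iff_real hx.symm).mp hst
    show T.negAbsLogQ ≤ T.negLogTheta
    rw [hΘ P l T x hx.symm, ← hq P l T]
    exact hle
  -- Step 2: VERBATIM the Statement-level steps of `Conditional.abc_of_S_v2`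
  refine ABC_of_thm110Legendre (ThetaPartIIDisplay.thm110Legendre_of_squeezeIII fun P hP l hl h5 hc h2 h5' h6 => ?_)
  obtain ⟨T⟩ := ThetaPartII.stub_thetaData P hP l hl h5 hc h2 h5' h6
  exact PointDict.logQAvoid_le_of_cor312AtDatum (h312 P l) (hvol P hP l hl h5 hc h2 h5' h6) T hP.1

end Summit.ABC.IUTFork.Charitable.D4Upper

end
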